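import Summits.Ventures.CertifiedManyBodySolver.Observables.SourcedGibbsTrialCapCfcSqPair
import Summits.Ventures.CertifiedManyBodySolver.Observables.SourcedGibbsTrialCapAFSpectrum
import HarnessLib

/-!
# The AF–BCS sourced cap in momentum space (XV-c): the `4 × 4` antiferromagnetic Nambu–Bloch block and the Fermi
# functional calculus on it in closed form

Cell hubbard-obs (seat hubbard-obs-pin-2). HONEST FRAMING: zero compute; the `4 × 4` real symmetric Bloch block
`H(ε, G; M, μ')` of the AF + `d`-wave-pinned BCS trial one-body operator (files (X)/(XIII): on the plane-wave quartet
`(p, 0), (p, 1), (p + Q, 0), (p + Q, 1)` the operator acts by this block with `ε = ε_p`, `G = 2√2 h ĝ_d(p)`), its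
square-closed pair structure, and the column `f_β(H)e₀` of the Fermi functional calculus `cfc f_β H`,
`f_β(x) = (1 − tanh(βx/2))/2`, in the closed form of the coefficient functions `c₀₀, c₁₀, c_{Q0}, c_{Q1}` of the kernel
cap `groundEnergy_dWaveSourceTorus_le_AFBCS_kSpace` — now as functions of REAL parameters `(ε, G)`, the form needed for
the Lipschitz-in-momentum (thermodynamic-limit) step (`AF-TL-PACKAGING.md` of the cell deposit, step 2). Not a statement
about order; not a superconductivity verdict.

* `afBlock` — the block; `afBlock_isHermitian`;
* `afBlock_sq_single_zero/two` — `H²e₀ = a e₀ + b e₂`, `H²e₂ = b e₀ + a' e₂` (`a = (ε−μ')² + G² + M²`,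
  `a' = (−ε−μ')² + G² + M²`, `b = −2μ'M`);
* `cfc_fermi_afBlock_mulVec_single_zero` — `f_β(H)e₀` by the square-closed-pair formula;
* `cfc_fermi_afBlock_apply_zero_zero` / `_one_zero` / `_two_zero` / `_three_zero` — the entries `F₀₀ = c₀₀(ε, G)`,
  `F₁₀ = c₁₀`, `F₂₀ = c_{Q0}`, `F₃₀ = c_{Q1}` in closed form (`μ' ≠ 0`, `M ≠ 0`).

References: Hirsch, PRB 31 (1985) 4403 (SDW mean field on the square lattice) [HirschPRB1985]; von Delft–Ralph (2001)
§4.2 [VondelftRalph2001]; Bach–Lieb–Solovej (1994) §2 [BachLiebSolovej1994].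
-/

noncomputable section

open Matrix Finset
open scoped ComplexConjugate ComplexOrder

namespace Summit.Ventures.CertifiedManyBodySolver.Observables

section AFBlock

/-- The `4 × 4` antiferromagnetic Nambu–Bloch block of the AF + `d`-wave-pinned BCS trial one-body operator at band
energy `ε`, gap `G`, staggered field `M`, trial chemical potential `μ'`, in the basis `(p,0), (p,1), (p+Q,0), (p+Q,1)`:
`[[ε−μ', G, M, 0], [G, −(ε−μ'), 0, M], [M, 0, −ε−μ', −G], [0, M, −G, ε+μ']]` (`ε_{p+Q} = −ε_p`, `ĝ_d(p+Q) = −ĝ_d(p)`).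
[cite: HirschPRB1985] [cite: VondelftRalph2001, §4.2] -/
def afBlock (ε G M μ' : ℝ) : Matrix (Fin 4) (Fin 4) ℂ :=
  !![((ε - μ' : ℝ) : ℂ), (G : ℂ), (M : ℂ), 0;
     (G : ℂ), ((-(ε - μ') : ℝ) : ℂ), 0, (M : ℂ);
     (M : ℂ), 0, ((-ε - μ' : ℝ) : ℂ), ((-G : ℝ) : ℂ);
     0, (M : ℂ), ((-G : ℝ) : ℂ), ((ε + μ' : ℝ) : ℂ)]

/-- The AF Nambu–Bloch block is Hermitian (real symmetric). [cite: HirschPRB1985] -/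
theorem afBlock_isHermitian (ε G M μ' : ℝ) : (afBlock ε G M μ').IsHermitian := by
  refine Matrix.IsHermitian.ext fun i j => ?_
  fin_cases i <;> fin_cases j <;> simp [afBlock, Complex.conj_ofReal]

/-- `H e₀ = (ε−μ', G, M, 0)`. [cite: HirschPRB1985] -/
theorem afBlock_mulVec_single_zero (ε G M μ' : ℝ) :
    afBlock ε G M μ' *ᵥ Pi.single 0 1 = ![((ε - μ' : ℝ) : ℂ), (G : ℂ), (M : ℂ), 0] := by
  rw [Matrix.mulVec_single_one]
  ext i; fin_cases i <;> simp [afBlock]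

/-- `H e₂ = (M, 0, −ε−μ', −G)`. [cite: HirschPRB1985] -/
theorem afBlock_mulVec_single_two (ε G M μ' : ℝ) :
    afBlock ε G M μ' *ᵥ Pi.single 2 1 = ![(M : ℂ), 0, ((-ε - μ' : ℝ) : ℂ), ((-G : ℝ) : ℂ)] := by
  rw [Matrix.mulVec_single_one]
  ext i; fin_cases i <;> simp [afBlock]

/-- Square-closed pair, particle sheet: `H²e₀ = a e₀ + b e₂` with `a = (ε−μ')² + G² + M²`, `b = −2μ'M`.
[cite: HirschPRB1985] -/
theorem afBlock_sq_single_zero (ε G M μ' : ℝ) :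
    afBlock ε G M μ' *ᵥ (afBlock ε G M μ' *ᵥ Pi.single 0 1) =
      (((ε - μ') ^ 2 + G ^ 2 + M ^ 2 : ℝ) : ℂ) • Pi.single 0 1 + ((-(2 * μ' * M) : ℝ) : ℂ) • Pi.single 2 1 := by
  rw [afBlock_mulVec_single_zero]
  ext i; fin_cases i <;> simp [afBlock, Matrix.mulVec, dotProduct, Fin.sum_univ_four] <;> ring

/-- Square-closed pair, particle sheet: `H²e₂ = b e₀ + a' e₂` with `a' = (−ε−μ')² + G² + M²`. [cite: HirschPRB1985] -/
theorem afBlock_sq_single_two (ε G M μ' : ℝ) :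
    afBlock ε G M μ' *ᵥ (afBlock ε G M μ' *ᵥ Pi.single 2 1) =
      ((-(2 * μ' * M) : ℝ) : ℂ) • Pi.single 0 1 + (((-ε - μ') ^ 2 + G ^ 2 + M ^ 2 : ℝ) : ℂ) • Pi.single 2 1 := by
  rw [afBlock_mulVec_single_two]
  ext i; fin_cases i <;> simp [afBlock, Matrix.mulVec, dotProduct, Fin.sum_univ_four] <;> ring

/-- **`f_β(H)e₀` for the AF block** by the square-closed-pair formula (`cfc_fermi_mulVec_of_sq_pair` with
`a = (ε−μ')² + G² + M²`, `a' = (−ε−μ')² + G² + M²`, `b = −2μ'M`; side conditions from `af_sq_block_sum_nonneg`,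
`af_sq_block_det_nonneg`). [cite: VondelftRalph2001, §4.2] [cite: BachLiebSolovej1994, §2] -/
theorem cfc_fermi_afBlock_mulVec_single_zero (ε G M μ' β : ℝ) :
    cfc (fun x : ℝ => (1 - Real.tanh (β * x / 2)) / 2) (afBlock ε G M μ') *ᵥ Pi.single 0 1 =
      ((1 / 2 : ℝ) : ℂ) • Pi.single 0 1 -
        ((Real.tanh (β * Real.sqrt ((((ε - μ') ^ 2 + G ^ 2 + M ^ 2) + ((-ε - μ') ^ 2 + G ^ 2 + M ^ 2)) / 2 +
            Real.sqrt (((((ε - μ') ^ 2 + G ^ 2 + M ^ 2) - ((-ε - μ') ^ 2 + G ^ 2 + M ^ 2)) / 2) ^ 2 + (-(2 * μ' * M)) ^ 2)) / 2) /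
            (2 * Real.sqrt ((((ε - μ') ^ 2 + G ^ 2 + M ^ 2) + ((-ε - μ') ^ 2 + G ^ 2 + M ^ 2)) / 2 +
              Real.sqrt (((((ε - μ') ^ 2 + G ^ 2 + M ^ 2) - ((-ε - μ') ^ 2 + G ^ 2 + M ^ 2)) / 2) ^ 2 + (-(2 * μ' * M)) ^ 2))) : ℝ) : ℂ) •
          (afBlock ε G M μ' *ᵥ (((1 / 2 : ℝ) : ℂ) • Pi.single 0 1 +
            ((1 / (2 * Real.sqrt (((((ε - μ') ^ 2 + G ^ 2 + M ^ 2) - ((-ε - μ') ^ 2 + G ^ 2 + M ^ 2)) / 2) ^ 2 + (-(2 * μ' * M)) ^ 2)) : ℝ) : ℂ) •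
              (afBlock ε G M μ' *ᵥ (afBlock ε G M μ' *ᵥ Pi.single 0 1) -
                (((((ε - μ') ^ 2 + G ^ 2 + M ^ 2) + ((-ε - μ') ^ 2 + G ^ 2 + M ^ 2)) / 2 : ℝ) : ℂ) • Pi.single 0 1))) -
        ((Real.tanh (β * Real.sqrt ((((ε - μ') ^ 2 + G ^ 2 + M ^ 2) + ((-ε - μ') ^ 2 + G ^ 2 + M ^ 2)) / 2 -
            Real.sqrt (((((ε - μ') ^ 2 + G ^ 2 + M ^ 2) - ((-ε - μ') ^ 2 + G ^ 2 + M ^ 2)) / 2) ^ 2 + (-(2 * μ' * M)) ^ 2)) / 2) /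
            (2 * Real.sqrt ((((ε - μ') ^ 2 + G ^ 2 + M ^ 2) + ((-ε - μ') ^ 2 + G ^ 2 + M ^ 2)) / 2 -
              Real.sqrt (((((ε - μ') ^ 2 + G ^ 2 + M ^ 2) - ((-ε - μ') ^ 2 + G ^ 2 + M ^ 2)) / 2) ^ 2 + (-(2 * μ' * M)) ^ 2))) : ℝ) : ℂ) •
          (afBlock ε G M μ' *ᵥ (((1 / 2 : ℝ) : ℂ) • Pi.single 0 1 -
            ((1 / (2 * Real.sqrt (((((ε - μ') ^ 2 + G ^ 2 + M ^ 2) - ((-ε - μ') ^ 2 + G ^ 2 + M ^ 2)) / 2) ^ 2 + (-(2 * μ' * M)) ^ 2)) : ℝ) : ℂ) •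
              (afBlock ε G M μ' *ᵥ (afBlock ε G M μ' *ᵥ Pi.single 0 1) -
                (((((ε - μ') ^ 2 + G ^ 2 + M ^ 2) + ((-ε - μ') ^ 2 + G ^ 2 + M ^ 2)) / 2 : ℝ) : ℂ) • Pi.single 0 1))) :=
  cfc_fermi_mulVec_of_sq_pair (afBlock_isHermitian ε G M μ') β (afBlock_sq_single_zero ε G M μ')
    (afBlock_sq_single_two ε G M μ') (af_sq_block_sum_nonneg ε μ' G M) (af_sq_block_det_nonneg ε μ' G M)

/-- **The particle column of `f_β(H)` in closed form** (`μ' ≠ 0`, `M ≠ 0`; `R = √(ε² + M²)`,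
`E_± = √((R ± |μ'|)² + G²)`, `Q_± = tanh(βE_±/2)/(2E_±)`, `κ = μ'/(2|μ'|R)`, `ξ = ε − μ'`, `W = ε² + M² − εμ'`):
`f_β(H)e₀ = (c₀₀, c₁₀, c_{Q0}, c_{Q1})` with `c₀₀ = ½ − Q₊(ξ/2 − κW) − Q₋(ξ/2 + κW)`,
`c₁₀ = −G(Q₊(½ − κε) + Q₋(½ + κε))`, `c_{Q0} = −M(Q₊(½ + κμ') + Q₋(½ − κμ'))`, `c_{Q1} = −κMG(Q₊ − Q₋)` — the
coefficient functions of `fermi_afNambu_mulVec_planeWave_zero` / the kernel cap, as functions of real `(ε, G)`.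
[cite: HirschPRB1985] [cite: VondelftRalph2001, §4.2] -/
theorem cfc_fermi_afBlock_mulVec_single_zero_eq (ε G M μ' β : ℝ) (hμ : μ' ≠ 0) (hM : M ≠ 0) :
    cfc (fun x : ℝ => (1 - Real.tanh (β * x / 2)) / 2) (afBlock ε G M μ') *ᵥ Pi.single 0 1 =
      ![((1 / 2 -
            Real.tanh (β * Real.sqrt ((Real.sqrt (ε ^ 2 + M ^ 2) + |μ'|) ^ 2 + G ^ 2) / 2) /
                (2 * Real.sqrt ((Real.sqrt (ε ^ 2 + M ^ 2) + |μ'|) ^ 2 + G ^ 2)) *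
              ((ε - μ') / 2 - μ' / (2 * |μ'| * Real.sqrt (ε ^ 2 + M ^ 2)) * (ε ^ 2 + M ^ 2 - ε * μ')) -
            Real.tanh (β * Real.sqrt ((Real.sqrt (ε ^ 2 + M ^ 2) - |μ'|) ^ 2 + G ^ 2) / 2) /
                (2 * Real.sqrt ((Real.sqrt (ε ^ 2 + M ^ 2) - |μ'|) ^ 2 + G ^ 2)) *
              ((ε - μ') / 2 + μ' / (2 * |μ'| * Real.sqrt (ε ^ 2 + M ^ 2)) * (ε ^ 2 + M ^ 2 - ε * μ')) : ℝ) : ℂ),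
        ((-G * (Real.tanh (β * Real.sqrt ((Real.sqrt (ε ^ 2 + M ^ 2) + |μ'|) ^ 2 + G ^ 2) / 2) /
                (2 * Real.sqrt ((Real.sqrt (ε ^ 2 + M ^ 2) + |μ'|) ^ 2 + G ^ 2)) *
              (1 / 2 - μ' / (2 * |μ'| * Real.sqrt (ε ^ 2 + M ^ 2)) * ε) +
            Real.tanh (β * Real.sqrt ((Real.sqrt (ε ^ 2 + M ^ 2) - |μ'|) ^ 2 + G ^ 2) / 2) /
                (2 * Real.sqrt ((Real.sqrt (ε ^ 2 + M ^ 2) - |μ'|) ^ 2 + G ^ 2)) *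
              (1 / 2 + μ' / (2 * |μ'| * Real.sqrt (ε ^ 2 + M ^ 2)) * ε)) : ℝ) : ℂ),
        ((-M * (Real.tanh (β * Real.sqrt ((Real.sqrt (ε ^ 2 + M ^ 2) + |μ'|) ^ 2 + G ^ 2) / 2) /
                (2 * Real.sqrt ((Real.sqrt (ε ^ 2 + M ^ 2) + |μ'|) ^ 2 + G ^ 2)) *
              (1 / 2 + μ' / (2 * |μ'| * Real.sqrt (ε ^ 2 + M ^ 2)) * μ') +
            Real.tanh (β * Real.sqrt ((Real.sqrt (ε ^ 2 + M ^ 2) - |μ'|) ^ 2 + G ^ 2) / 2) /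
                (2 * Real.sqrt ((Real.sqrt (ε ^ 2 + M ^ 2) - |μ'|) ^ 2 + G ^ 2)) *
              (1 / 2 - μ' / (2 * |μ'| * Real.sqrt (ε ^ 2 + M ^ 2)) * μ')) : ℝ) : ℂ),
        ((-(μ' / (2 * |μ'| * Real.sqrt (ε ^ 2 + M ^ 2))) * M * G *
            (Real.tanh (β * Real.sqrt ((Real.sqrt (ε ^ 2 + M ^ 2) + |μ'|) ^ 2 + G ^ 2) / 2) /
                (2 * Real.sqrt ((Real.sqrt (ε ^ 2 + M ^ 2) + |μ'|) ^ 2 + G ^ 2)) -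
              Real.tanh (β * Real.sqrt ((Real.sqrt (ε ^ 2 + M ^ 2) - |μ'|) ^ 2 + G ^ 2) / 2) /
                (2 * Real.sqrt ((Real.sqrt (ε ^ 2 + M ^ 2) - |μ'|) ^ 2 + G ^ 2))) : ℝ) : ℂ)] := by
  rw [cfc_fermi_afBlock_mulVec_single_zero, afBlock_sq_single_zero, af_sq_block_eigen_plus ε μ' G M,
    af_sq_block_eigen_minus ε μ' G M, af_sq_block_sqrt_disc ε μ' G M]
  -- name the two Fermi factors and the radius (they are common to both sides)
  generalize Real.tanh (β * Real.sqrt ((Real.sqrt (ε ^ 2 + M ^ 2) + |μ'|) ^ 2 + G ^ 2) / 2) /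
      (2 * Real.sqrt ((Real.sqrt (ε ^ 2 + M ^ 2) + |μ'|) ^ 2 + G ^ 2)) = Qp
  generalize Real.tanh (β * Real.sqrt ((Real.sqrt (ε ^ 2 + M ^ 2) - |μ'|) ^ 2 + G ^ 2) / 2) /
      (2 * Real.sqrt ((Real.sqrt (ε ^ 2 + M ^ 2) - |μ'|) ^ 2 + G ^ 2)) = Qm
  have hR0 : Real.sqrt (ε ^ 2 + M ^ 2) ≠ 0 := by
    have : 0 < ε ^ 2 + M ^ 2 := by positivity
    exact (Real.sqrt_pos.2 this).ne'
  have ha0 : |μ'| ≠ 0 := abs_ne_zero.2 hμ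
  generalize Real.sqrt (ε ^ 2 + M ^ 2) = R at hR0 ⊢
  have hRc : (R : ℂ) ≠ 0 := Complex.ofReal_ne_zero.2 hR0
  have hac : ((|μ'| : ℝ) : ℂ) ≠ 0 := Complex.ofReal_ne_zero.2 ha0
  have hs0 : (Pi.single 0 1 : Fin 4 → ℂ) = ![1, 0, 0, 0] := by
    ext i; fin_cases i <;> simp
  simp only [Matrix.mulVec_add, Matrix.mulVec_sub, Matrix.mulVec_smul, afBlock_mulVec_single_zero,
    afBlock_mulVec_single_two]
  simp only [hs0]
  ext i
  fin_cases i
  all_goals simp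
  all_goals field_simp; ring

end AFBlock

end Summit.Ventures.CertifiedManyBodySolver.Observables
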